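import Mathlib.Data.Real.Basic
import Mathlib.Tactic.Linarith
import Mathlib.Tactic.Positivity
import HarnessLib

/-!
# The six-reals tangent inequality (Sahi programme, cell prim-sahi, prover prim-sahi-p2 gen 32)

Support file (`--supports stmt-CriticalPhenomena-4575`).  No definitions, no named facts, no sorries; standard axioms.  Pure real algebra;
the companion `…SahiTangentChain` turns it into the tangent inequality `E₃ ≥ ∂E₃` on every finite chain.
Memo `run/shared/lean/prim/prim-sahi/FROM-prim-sahi-p2-gen32-TANGENT.md`, `prim-sahi-p2/PROOF-E3.md` §42.

For a probability weight `μ` on a finite chain and up-sets `U₀ ⊆ U₁`, `V₀ ⊆ V₁`, `W₀ ⊆ W₁` put `A_a = μ(U_a)`, `B_a = μ(V_a)`, `C_a = μ(W_a)`;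
up-sets of a chain are nested, so `μ(U ∩ V) = min(μ U, μ V)` and the tangent functional
`T₃ = 2⟨u₀v₀w₀⟩ + Σ_cyc (⟨u₁⟩−⟨u₀⟩)⟨v₁w₁⟩ + Σ_cyc ⟨u₀⟩⟨v₁⟩⟨w₁⟩ − Σ_cyc ⟨u₁⟩⟨v₀w₀⟩ − 2⟨u₁⟩⟨v₁⟩⟨w₁⟩` (`u_a = χ_{U_a}`, `⟨·⟩ = E_μ`)
becomes the function of six reals below.  We prove it is `≥ 0` on `0 ≤ A₀ ≤ A₁ ≤ 1`, `0 ≤ B₀ ≤ B₁ ≤ 1`, `0 ≤ C₀ ≤ C₁ ≤ 1`: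

* `tangent_six_reals_sorted` — the case `A₀ ≤ B₀ ≤ C₀`: fifteen interleavings of `A₁, B₁, C₁` with `B₀ ≤ C₀ ≤ …`; in each the margin is an
  explicit nonnegative combination of at most six products of three gaps of the interleaved chain `0 ≤ A₀ ≤ … ≤ 1` (certificates found by a
  greedy interval-product search over the exact gap expansion, which has nonnegative coefficients in all 90 interleavings; checked by `nlinarith`).
* `tangent_six_reals` — general, by the symmetry of the statement in the three pairs.
Both `A₀ ≤ A₁` and `A₁ ≤ 1` are needed: `(A₀,A₁,B₀,B₁,C₀,C₁) = (1,1,1,¾,¾,1)` resp. `(3/2,2,3/2,2,3/2,2)` make the margin negative.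
-/

namespace Summit.CriticalPhenomena.PercolationContinuityZ3.Theorems.SahiTangent

/-! ### The six-reals inequality -/

/-- The six-reals core of the tangent inequality on a chain, level-0 values sorted (`A₀ ≤ B₀ ≤ C₀`): for
`0 ≤ A₀ ≤ B₀ ≤ C₀`, `A₀ ≤ A₁ ≤ 1`, `B₀ ≤ B₁ ≤ 1`, `C₀ ≤ C₁ ≤ 1`,
`0 ≤ 2A₀ + (A₁−A₀)·min(B₁,C₁) + (B₁−B₀)·min(A₁,C₁) + (C₁−C₀)·min(A₁,B₁) + A₀B₁C₁ + B₀A₁C₁ + C₀A₁B₁ − A₁B₀ − B₁A₀ − C₁A₀ − 2A₁B₁C₁`.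
Proof: the fifteen interleavings of `A₁, B₁, C₁` with `B₀ ≤ C₀`; in each the margin is an explicit nonnegative combination of at most six products of
three gaps of the interleaved chain `0 ≤ A₀ ≤ … ≤ 1` (certificates found by a greedy interval-product search, checked here by `nlinarith`). [this work] -/
theorem tangent_six_reals_sorted {A₀ A₁ B₀ B₁ C₀ C₁ : ℝ} (hA₀ : 0 ≤ A₀) (hAB : A₀ ≤ B₀) (hBC : B₀ ≤ C₀)
    (hA : A₀ ≤ A₁) (hB : B₀ ≤ B₁) (hC : C₀ ≤ C₁) (hA₁ : A₁ ≤ 1) (hB₁ : B₁ ≤ 1) (hC₁ : C₁ ≤ 1) :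
    0 ≤ 2 * A₀ + (A₁ - A₀) * min B₁ C₁ + (B₁ - B₀) * min A₁ C₁ + (C₁ - C₀) * min A₁ B₁
      + A₀ * B₁ * C₁ + B₀ * A₁ * C₁ + C₀ * A₁ * B₁ - A₁ * B₀ - B₁ * A₀ - C₁ * A₀ - 2 * A₁ * B₁ * C₁ := by
  rcases le_total B₁ C₀ with hb | hb
  · -- chain B₀ ≤ B₁ ≤ C₀ ≤ C₁
    rw [min_eq_left (le_trans hb hC : B₁ ≤ C₁)]
    rcases le_total A₁ B₀ with h1 | h1
    · -- A₁ ≤ B₀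
      rw [min_eq_left (by linarith : A₁ ≤ C₁), min_eq_left (by linarith : A₁ ≤ B₁)]
      nlinarith [mul_nonneg (mul_nonneg (by linarith : (0:ℝ) ≤ A₀) (by linarith : (0:ℝ) ≤ 1)) (by linarith : (0:ℝ) ≤ 1 - B₀),
        mul_nonneg (mul_nonneg (by linarith : (0:ℝ) ≤ 1) (by linarith : (0:ℝ) ≤ A₁ - A₀)) (by linarith : (0:ℝ) ≤ B₁ - B₀),
        mul_nonneg (mul_nonneg (by linarith : (0:ℝ) ≤ A₀) (by linarith : (0:ℝ) ≤ 1 - B₁)) (by linarith : (0:ℝ) ≤ 1 - C₀),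
        mul_nonneg (mul_nonneg (by linarith : (0:ℝ) ≤ A₁ - A₀) (by linarith : (0:ℝ) ≤ 1 - B₁)) (by linarith : (0:ℝ) ≤ C₁ - C₀),
        mul_nonneg (mul_nonneg (by linarith : (0:ℝ) ≤ A₁) (by linarith : (0:ℝ) ≤ B₁ - B₀)) (by linarith : (0:ℝ) ≤ 1 - C₁)]
    · -- B₀ ≤ A₁
      rcases le_total A₁ B₁ with h2 | h2
      · -- A₁ ≤ B₁
        rw [min_eq_left (by linarith : A₁ ≤ C₁), min_eq_left (by linarith : A₁ ≤ B₁)]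
        nlinarith [mul_nonneg (mul_nonneg (by linarith : (0:ℝ) ≤ A₁) (by linarith : (0:ℝ) ≤ 1)) (by linarith : (0:ℝ) ≤ B₁ - B₀),
          mul_nonneg (mul_nonneg (by linarith : (0:ℝ) ≤ A₀) (by linarith : (0:ℝ) ≤ 1)) (by linarith : (0:ℝ) ≤ 1 - B₁),
          mul_nonneg (mul_nonneg (by linarith : (0:ℝ) ≤ A₁) (by linarith : (0:ℝ) ≤ 1 - B₁)) (by linarith : (0:ℝ) ≤ C₁ - C₀),
          mul_nonneg (mul_nonneg (by linarith : (0:ℝ) ≤ A₁) (by linarith : (0:ℝ) ≤ B₁ - B₀)) (by linarith : (0:ℝ) ≤ 1 - C₁),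
          mul_nonneg (mul_nonneg (by linarith : (0:ℝ) ≤ A₀) (by linarith : (0:ℝ) ≤ 1 - B₁)) (by linarith : (0:ℝ) ≤ 1 - C₁)]
      · -- B₁ ≤ A₁
        rcases le_total A₁ C₀ with h3 | h3
        · -- A₁ ≤ C₀
          rw [min_eq_left (by linarith : A₁ ≤ C₁), min_eq_right (by linarith : B₁ ≤ A₁)]
          nlinarith [mul_nonneg (mul_nonneg (by linarith : (0:ℝ) ≤ A₀) (by linarith : (0:ℝ) ≤ 1)) (by linarith : (0:ℝ) ≤ 1 - B₀),
            mul_nonneg (mul_nonneg (by linarith : (0:ℝ) ≤ 1) (by linarith : (0:ℝ) ≤ A₁ - A₀)) (by linarith : (0:ℝ) ≤ B₁ - B₀),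
            mul_nonneg (mul_nonneg (by linarith : (0:ℝ) ≤ B₁) (by linarith : (0:ℝ) ≤ 1 - A₁)) (by linarith : (0:ℝ) ≤ C₁ - C₀),
            mul_nonneg (mul_nonneg (by linarith : (0:ℝ) ≤ A₀) (by linarith : (0:ℝ) ≤ 1 - B₀)) (by linarith : (0:ℝ) ≤ 1 - C₁),
            mul_nonneg (mul_nonneg (by linarith : (0:ℝ) ≤ A₁ - A₀) (by linarith : (0:ℝ) ≤ B₁ - B₀)) (by linarith : (0:ℝ) ≤ 1 - C₁)]
        · -- C₀ ≤ A₁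
          rcases le_total A₁ C₁ with h4 | h4
          · -- A₁ ≤ C₁
            rw [min_eq_left (by linarith : A₁ ≤ C₁), min_eq_right (by linarith : B₁ ≤ A₁)]
            nlinarith [mul_nonneg (mul_nonneg (by linarith : (0:ℝ) ≤ A₀) (by linarith : (0:ℝ) ≤ 1)) (by linarith : (0:ℝ) ≤ 1 - B₀),
              mul_nonneg (mul_nonneg (by linarith : (0:ℝ) ≤ 1) (by linarith : (0:ℝ) ≤ A₁ - A₀)) (by linarith : (0:ℝ) ≤ B₁ - B₀),
              mul_nonneg (mul_nonneg (by linarith : (0:ℝ) ≤ B₁) (by linarith : (0:ℝ) ≤ C₁ - C₀)) (by linarith : (0:ℝ) ≤ 1 - A₁),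
              mul_nonneg (mul_nonneg (by linarith : (0:ℝ) ≤ A₀) (by linarith : (0:ℝ) ≤ 1 - B₀)) (by linarith : (0:ℝ) ≤ 1 - C₁),
              mul_nonneg (mul_nonneg (by linarith : (0:ℝ) ≤ A₁ - A₀) (by linarith : (0:ℝ) ≤ B₁ - B₀)) (by linarith : (0:ℝ) ≤ 1 - C₁)]
          · -- C₁ ≤ A₁
            rw [min_eq_right (by linarith : C₁ ≤ A₁), min_eq_right (by linarith : B₁ ≤ A₁)]
            nlinarith [mul_nonneg (mul_nonneg (by linarith : (0:ℝ) ≤ A₁) (by linarith : (0:ℝ) ≤ 1)) (by linarith : (0:ℝ) ≤ B₁ - B₀),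
              mul_nonneg (mul_nonneg (by linarith : (0:ℝ) ≤ A₀) (by linarith : (0:ℝ) ≤ 1)) (by linarith : (0:ℝ) ≤ 1 - B₁),
              mul_nonneg (mul_nonneg (by linarith : (0:ℝ) ≤ A₀) (by linarith : (0:ℝ) ≤ 1 - B₁)) (by linarith : (0:ℝ) ≤ 1 - C₁),
              mul_nonneg (mul_nonneg (by linarith : (0:ℝ) ≤ C₁) (by linarith : (0:ℝ) ≤ B₁ - B₀)) (by linarith : (0:ℝ) ≤ 1 - A₁),
              mul_nonneg (mul_nonneg (by linarith : (0:ℝ) ≤ B₁) (by linarith : (0:ℝ) ≤ C₁ - C₀)) (by linarith : (0:ℝ) ≤ 1 - A₁)]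
  · rcases le_total B₁ C₁ with hb' | hb'
    · -- chain B₀ ≤ C₀ ≤ B₁ ≤ C₁
      rw [min_eq_left hb']
      rcases le_total A₁ B₀ with h1 | h1
      · -- A₁ ≤ B₀
        rw [min_eq_left (by linarith : A₁ ≤ C₁), min_eq_left (by linarith : A₁ ≤ B₁)]
        nlinarith [mul_nonneg (mul_nonneg (by linarith : (0:ℝ) ≤ A₀) (by linarith : (0:ℝ) ≤ 1)) (by linarith : (0:ℝ) ≤ 1 - B₀),
          mul_nonneg (mul_nonneg (by linarith : (0:ℝ) ≤ 1) (by linarith : (0:ℝ) ≤ A₁ - A₀)) (by linarith : (0:ℝ) ≤ B₁ - B₀),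
          mul_nonneg (mul_nonneg (by linarith : (0:ℝ) ≤ A₁) (by linarith : (0:ℝ) ≤ C₁ - C₀)) (by linarith : (0:ℝ) ≤ 1 - B₁),
          mul_nonneg (mul_nonneg (by linarith : (0:ℝ) ≤ A₀) (by linarith : (0:ℝ) ≤ 1 - B₀)) (by linarith : (0:ℝ) ≤ 1 - C₁),
          mul_nonneg (mul_nonneg (by linarith : (0:ℝ) ≤ A₁ - A₀) (by linarith : (0:ℝ) ≤ B₁ - B₀)) (by linarith : (0:ℝ) ≤ 1 - C₁)]
      · -- B₀ ≤ A₁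
        rcases le_total A₁ C₀ with h2 | h2
        · -- A₁ ≤ C₀
          rw [min_eq_left (by linarith : A₁ ≤ C₁), min_eq_left (by linarith : A₁ ≤ B₁)]
          nlinarith [mul_nonneg (mul_nonneg (by linarith : (0:ℝ) ≤ A₁) (by linarith : (0:ℝ) ≤ 1)) (by linarith : (0:ℝ) ≤ B₁ - B₀),
            mul_nonneg (mul_nonneg (by linarith : (0:ℝ) ≤ A₀) (by linarith : (0:ℝ) ≤ 1)) (by linarith : (0:ℝ) ≤ 1 - B₁),
            mul_nonneg (mul_nonneg (by linarith : (0:ℝ) ≤ A₁) (by linarith : (0:ℝ) ≤ C₁ - B₀)) (by linarith : (0:ℝ) ≤ 1 - C₁),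
            mul_nonneg (mul_nonneg (by linarith : (0:ℝ) ≤ A₁) (by linarith : (0:ℝ) ≤ B₁ - C₀)) (by linarith : (0:ℝ) ≤ 1 - B₁),
            mul_nonneg (mul_nonneg (by linarith : (0:ℝ) ≤ A₁) (by linarith : (0:ℝ) ≤ C₁ - B₁)) (by linarith : (0:ℝ) ≤ C₁ - B₁),
            mul_nonneg (mul_nonneg (by linarith : (0:ℝ) ≤ A₀) (by linarith : (0:ℝ) ≤ 1 - B₁)) (by linarith : (0:ℝ) ≤ 1 - C₁)]
        · -- C₀ ≤ A₁
          rcases le_total A₁ B₁ with h3 | h3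
          · -- A₁ ≤ B₁
            rw [min_eq_left (by linarith : A₁ ≤ C₁), min_eq_left (by linarith : A₁ ≤ B₁)]
            nlinarith [mul_nonneg (mul_nonneg (by linarith : (0:ℝ) ≤ A₁) (by linarith : (0:ℝ) ≤ 1)) (by linarith : (0:ℝ) ≤ B₁ - B₀),
              mul_nonneg (mul_nonneg (by linarith : (0:ℝ) ≤ A₁) (by linarith : (0:ℝ) ≤ C₁ - C₀)) (by linarith : (0:ℝ) ≤ 1 - B₁),
              mul_nonneg (mul_nonneg (by linarith : (0:ℝ) ≤ A₀) (by linarith : (0:ℝ) ≤ 1)) (by linarith : (0:ℝ) ≤ 1 - B₁),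
              mul_nonneg (mul_nonneg (by linarith : (0:ℝ) ≤ A₁) (by linarith : (0:ℝ) ≤ B₁ - B₀)) (by linarith : (0:ℝ) ≤ 1 - C₁),
              mul_nonneg (mul_nonneg (by linarith : (0:ℝ) ≤ A₀) (by linarith : (0:ℝ) ≤ 1 - B₁)) (by linarith : (0:ℝ) ≤ 1 - C₁)]
          · -- B₁ ≤ A₁
            rcases le_total A₁ C₁ with h4 | h4
            · -- A₁ ≤ C₁
              rw [min_eq_left (by linarith : A₁ ≤ C₁), min_eq_right (by linarith : B₁ ≤ A₁)]
              nlinarith [mul_nonneg (mul_nonneg (by linarith : (0:ℝ) ≤ A₁) (by linarith : (0:ℝ) ≤ 1)) (by linarith : (0:ℝ) ≤ B₁ - B₀),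
                mul_nonneg (mul_nonneg (by linarith : (0:ℝ) ≤ B₁) (by linarith : (0:ℝ) ≤ C₁ - C₀)) (by linarith : (0:ℝ) ≤ 1 - A₁),
                mul_nonneg (mul_nonneg (by linarith : (0:ℝ) ≤ A₀) (by linarith : (0:ℝ) ≤ 1)) (by linarith : (0:ℝ) ≤ 1 - B₁),
                mul_nonneg (mul_nonneg (by linarith : (0:ℝ) ≤ A₁) (by linarith : (0:ℝ) ≤ B₁ - B₀)) (by linarith : (0:ℝ) ≤ 1 - C₁),
                mul_nonneg (mul_nonneg (by linarith : (0:ℝ) ≤ A₀) (by linarith : (0:ℝ) ≤ 1 - B₁)) (by linarith : (0:ℝ) ≤ 1 - C₁)]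
            · -- C₁ ≤ A₁
              rw [min_eq_right (by linarith : C₁ ≤ A₁), min_eq_right (by linarith : B₁ ≤ A₁)]
              nlinarith [mul_nonneg (mul_nonneg (by linarith : (0:ℝ) ≤ A₁) (by linarith : (0:ℝ) ≤ 1)) (by linarith : (0:ℝ) ≤ B₁ - B₀),
                mul_nonneg (mul_nonneg (by linarith : (0:ℝ) ≤ A₀) (by linarith : (0:ℝ) ≤ 1)) (by linarith : (0:ℝ) ≤ 1 - B₁),
                mul_nonneg (mul_nonneg (by linarith : (0:ℝ) ≤ B₁) (by linarith : (0:ℝ) ≤ C₁ - B₀)) (by linarith : (0:ℝ) ≤ 1 - A₁),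
                mul_nonneg (mul_nonneg (by linarith : (0:ℝ) ≤ A₀) (by linarith : (0:ℝ) ≤ 1 - B₁)) (by linarith : (0:ℝ) ≤ 1 - C₁),
                mul_nonneg (mul_nonneg (by linarith : (0:ℝ) ≤ C₁) (by linarith : (0:ℝ) ≤ B₁ - C₀)) (by linarith : (0:ℝ) ≤ 1 - A₁),
                mul_nonneg (mul_nonneg (by linarith : (0:ℝ) ≤ C₀ - B₀) (by linarith : (0:ℝ) ≤ C₁ - B₁)) (by linarith : (0:ℝ) ≤ 1 - A₁)]
    · -- chain B₀ ≤ C₀ ≤ C₁ ≤ B₁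
      rw [min_eq_right hb']
      rcases le_total A₁ B₀ with h1 | h1
      · -- A₁ ≤ B₀
        rw [min_eq_left (by linarith : A₁ ≤ C₁), min_eq_left (by linarith : A₁ ≤ B₁)]
        nlinarith [mul_nonneg (mul_nonneg (by linarith : (0:ℝ) ≤ A₀) (by linarith : (0:ℝ) ≤ 1)) (by linarith : (0:ℝ) ≤ 1 - B₀),
          mul_nonneg (mul_nonneg (by linarith : (0:ℝ) ≤ 1) (by linarith : (0:ℝ) ≤ A₁ - A₀)) (by linarith : (0:ℝ) ≤ C₁ - B₀),
          mul_nonneg (mul_nonneg (by linarith : (0:ℝ) ≤ A₁) (by linarith : (0:ℝ) ≤ B₁ - B₀)) (by linarith : (0:ℝ) ≤ 1 - C₁),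
          mul_nonneg (mul_nonneg (by linarith : (0:ℝ) ≤ A₀) (by linarith : (0:ℝ) ≤ 1 - C₀)) (by linarith : (0:ℝ) ≤ 1 - B₁),
          mul_nonneg (mul_nonneg (by linarith : (0:ℝ) ≤ A₁ - A₀) (by linarith : (0:ℝ) ≤ C₁ - C₀)) (by linarith : (0:ℝ) ≤ 1 - B₁)]
      · -- B₀ ≤ A₁
        rcases le_total A₁ C₀ with h2 | h2
        · -- A₁ ≤ C₀
          rw [min_eq_left (by linarith : A₁ ≤ C₁), min_eq_left (by linarith : A₁ ≤ B₁)]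
          nlinarith [mul_nonneg (mul_nonneg (by linarith : (0:ℝ) ≤ A₁) (by linarith : (0:ℝ) ≤ 1)) (by linarith : (0:ℝ) ≤ C₁ - B₀),
            mul_nonneg (mul_nonneg (by linarith : (0:ℝ) ≤ A₁) (by linarith : (0:ℝ) ≤ B₁ - B₀)) (by linarith : (0:ℝ) ≤ 1 - C₁),
            mul_nonneg (mul_nonneg (by linarith : (0:ℝ) ≤ A₀) (by linarith : (0:ℝ) ≤ 1)) (by linarith : (0:ℝ) ≤ 1 - C₁),
            mul_nonneg (mul_nonneg (by linarith : (0:ℝ) ≤ A₀) (by linarith : (0:ℝ) ≤ 1 - C₀)) (by linarith : (0:ℝ) ≤ 1 - B₁),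
            mul_nonneg (mul_nonneg (by linarith : (0:ℝ) ≤ A₁ - A₀) (by linarith : (0:ℝ) ≤ C₁ - C₀)) (by linarith : (0:ℝ) ≤ 1 - B₁)]
        · -- C₀ ≤ A₁
          rcases le_total A₁ C₁ with h3 | h3
          · -- A₁ ≤ C₁
            rw [min_eq_left (by linarith : A₁ ≤ C₁), min_eq_left (by linarith : A₁ ≤ B₁)]
            nlinarith [mul_nonneg (mul_nonneg (by linarith : (0:ℝ) ≤ A₁) (by linarith : (0:ℝ) ≤ 1)) (by linarith : (0:ℝ) ≤ C₁ - B₀),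
              mul_nonneg (mul_nonneg (by linarith : (0:ℝ) ≤ A₁) (by linarith : (0:ℝ) ≤ B₁ - B₀)) (by linarith : (0:ℝ) ≤ 1 - C₁),
              mul_nonneg (mul_nonneg (by linarith : (0:ℝ) ≤ A₀) (by linarith : (0:ℝ) ≤ 1)) (by linarith : (0:ℝ) ≤ 1 - C₁),
              mul_nonneg (mul_nonneg (by linarith : (0:ℝ) ≤ A₁) (by linarith : (0:ℝ) ≤ C₁ - C₀)) (by linarith : (0:ℝ) ≤ 1 - B₁),
              mul_nonneg (mul_nonneg (by linarith : (0:ℝ) ≤ A₀) (by linarith : (0:ℝ) ≤ 1 - C₁)) (by linarith : (0:ℝ) ≤ 1 - B₁)]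
          · -- C₁ ≤ A₁
            rcases le_total A₁ B₁ with h4 | h4
            · -- A₁ ≤ B₁
              rw [min_eq_right (by linarith : C₁ ≤ A₁), min_eq_left (by linarith : A₁ ≤ B₁)]
              nlinarith [mul_nonneg (mul_nonneg (by linarith : (0:ℝ) ≤ B₁) (by linarith : (0:ℝ) ≤ 1)) (by linarith : (0:ℝ) ≤ C₁ - B₀),
                mul_nonneg (mul_nonneg (by linarith : (0:ℝ) ≤ A₀) (by linarith : (0:ℝ) ≤ 1)) (by linarith : (0:ℝ) ≤ 1 - C₁),
                mul_nonneg (mul_nonneg (by linarith : (0:ℝ) ≤ C₁) (by linarith : (0:ℝ) ≤ A₁ - B₀)) (by linarith : (0:ℝ) ≤ 1 - B₁),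
                mul_nonneg (mul_nonneg (by linarith : (0:ℝ) ≤ A₀) (by linarith : (0:ℝ) ≤ 1 - C₁)) (by linarith : (0:ℝ) ≤ 1 - A₁),
                mul_nonneg (mul_nonneg (by linarith : (0:ℝ) ≤ A₁) (by linarith : (0:ℝ) ≤ C₁ - C₀)) (by linarith : (0:ℝ) ≤ 1 - B₁),
                mul_nonneg (mul_nonneg (by linarith : (0:ℝ) ≤ B₀ - A₀) (by linarith : (0:ℝ) ≤ 1 - C₁)) (by linarith : (0:ℝ) ≤ B₁ - A₁)]
            · -- B₁ ≤ A₁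
              rw [min_eq_right (by linarith : C₁ ≤ A₁), min_eq_right (by linarith : B₁ ≤ A₁)]
              nlinarith [mul_nonneg (mul_nonneg (by linarith : (0:ℝ) ≤ A₁) (by linarith : (0:ℝ) ≤ 1)) (by linarith : (0:ℝ) ≤ C₁ - B₀),
                mul_nonneg (mul_nonneg (by linarith : (0:ℝ) ≤ A₀) (by linarith : (0:ℝ) ≤ 1)) (by linarith : (0:ℝ) ≤ 1 - C₁),
                mul_nonneg (mul_nonneg (by linarith : (0:ℝ) ≤ C₁) (by linarith : (0:ℝ) ≤ B₁ - B₀)) (by linarith : (0:ℝ) ≤ 1 - A₁),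
                mul_nonneg (mul_nonneg (by linarith : (0:ℝ) ≤ A₀) (by linarith : (0:ℝ) ≤ 1 - C₁)) (by linarith : (0:ℝ) ≤ 1 - B₁),
                mul_nonneg (mul_nonneg (by linarith : (0:ℝ) ≤ B₁) (by linarith : (0:ℝ) ≤ C₁ - C₀)) (by linarith : (0:ℝ) ≤ 1 - A₁)]

/-- **The six-reals tangent inequality.**  For `0 ≤ A₀ ≤ A₁ ≤ 1`, `0 ≤ B₀ ≤ B₁ ≤ 1`, `0 ≤ C₀ ≤ C₁ ≤ 1`:
`0 ≤ 2·min(A₀,B₀,C₀) + Σ_cyc (A₁−A₀)·min(B₁,C₁) + Σ_cyc A₀B₁C₁ − Σ_cyc A₁·min(B₀,C₀) − 2A₁B₁C₁`.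
On a finite chain with a probability weight, `A_a, B_a, C_a` are the masses of up-sets `U_a ⊇`-nested in `a` and `min` is the mass of an
intersection, so this IS the tangent inequality `E₃ ≥ ∂E₃` there (`tangent_chain_upperSet`); both hypotheses `· ≤ 1` and `A₀ ≤ A₁` are needed
(e.g. `(1,1,1,¾,¾,1)` and values `3/2, 2` violate the conclusion). [this work] -/
theorem tangent_six_reals {A₀ A₁ B₀ B₁ C₀ C₁ : ℝ} (hA₀ : 0 ≤ A₀) (hB₀ : 0 ≤ B₀) (hC₀ : 0 ≤ C₀)
    (hA : A₀ ≤ A₁) (hB : B₀ ≤ B₁) (hC : C₀ ≤ C₁) (hA₁ : A₁ ≤ 1) (hB₁ : B₁ ≤ 1) (hC₁ : C₁ ≤ 1) :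
    0 ≤ 2 * min A₀ (min B₀ C₀) + (A₁ - A₀) * min B₁ C₁ + (B₁ - B₀) * min A₁ C₁ + (C₁ - C₀) * min A₁ B₁
      + A₀ * B₁ * C₁ + B₀ * A₁ * C₁ + C₀ * A₁ * B₁ - A₁ * min B₀ C₀ - B₁ * min A₀ C₀ - C₁ * min A₀ B₀
      - 2 * A₁ * B₁ * C₁ := by
  rcases le_total A₀ B₀ with g1 | g1 <;> rcases le_total A₀ C₀ with g2 | g2 <;> rcases le_total B₀ C₀ with g3 | g3
  · -- A₀ ≤ B₀ ≤ C₀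
    have key := tangent_six_reals_sorted (A₀ := A₀) (A₁ := A₁) (B₀ := B₀) (B₁ := B₁) (C₀ := C₀) (C₁ := C₁)
      hA₀ (by linarith) (by linarith) hA hB hC hA₁ hB₁ hC₁
    have m1 : min B₀ C₀ = B₀ := min_eq_left (by linarith : B₀ ≤ C₀)
    have m2 : min A₀ C₀ = A₀ := min_eq_left (by linarith : A₀ ≤ C₀)
    have m3 : min A₀ B₀ = A₀ := min_eq_left (by linarith : A₀ ≤ B₀)
    have m4 : min A₀ (min B₀ C₀) = A₀ := by rw [m1]; exact min_eq_left (by linarith : A₀ ≤ B₀)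
    rw [m4, m1, m2, m3]
    linarith [key]
  · -- A₀ ≤ C₀ ≤ B₀
    have key := tangent_six_reals_sorted (A₀ := A₀) (A₁ := A₁) (B₀ := C₀) (B₁ := C₁) (C₀ := B₀) (C₁ := B₁)
      hA₀ (by linarith) (by linarith) hA hC hB hA₁ hC₁ hB₁
    have m1 : min B₀ C₀ = C₀ := min_eq_right (by linarith : C₀ ≤ B₀)
    have m2 : min A₀ C₀ = A₀ := min_eq_left (by linarith : A₀ ≤ C₀)
    have m3 : min A₀ B₀ = A₀ := min_eq_left (by linarith : A₀ ≤ B₀)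
    have m4 : min A₀ (min B₀ C₀) = A₀ := by rw [m1]; exact min_eq_left (by linarith : A₀ ≤ C₀)
    rw [m4, m1, m2, m3]
    rw [min_comm C₁ B₁] at key
    linarith [key]
  · -- A₀ ≤ B₀ ≤ C₀
    have key := tangent_six_reals_sorted (A₀ := A₀) (A₁ := A₁) (B₀ := B₀) (B₁ := B₁) (C₀ := C₀) (C₁ := C₁)
      hA₀ (by linarith) (by linarith) hA hB hC hA₁ hB₁ hC₁
    have m1 : min B₀ C₀ = B₀ := min_eq_left (by linarith : B₀ ≤ C₀)
    have m2 : min A₀ C₀ = A₀ := min_eq_left (by linarith : A₀ ≤ C₀)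
    have m3 : min A₀ B₀ = A₀ := min_eq_left (by linarith : A₀ ≤ B₀)
    have m4 : min A₀ (min B₀ C₀) = A₀ := by rw [m1]; exact min_eq_left (by linarith : A₀ ≤ B₀)
    rw [m4, m1, m2, m3]
    linarith [key]
  · -- C₀ ≤ A₀ ≤ B₀
    have key := tangent_six_reals_sorted (A₀ := C₀) (A₁ := C₁) (B₀ := A₀) (B₁ := A₁) (C₀ := B₀) (C₁ := B₁)
      hC₀ (by linarith) (by linarith) hC hA hB hC₁ hA₁ hB₁
    have m1 : min B₀ C₀ = C₀ := min_eq_right (by linarith : C₀ ≤ B₀)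
    have m2 : min A₀ C₀ = C₀ := min_eq_right (by linarith : C₀ ≤ A₀)
    have m3 : min A₀ B₀ = A₀ := min_eq_left (by linarith : A₀ ≤ B₀)
    have m4 : min A₀ (min B₀ C₀) = C₀ := by rw [m1]; exact min_eq_right (by linarith : C₀ ≤ A₀)
    rw [m4, m1, m2, m3]
    rw [min_comm C₁ B₁, min_comm C₁ A₁] at key
    linarith [key]
  · -- B₀ ≤ A₀ ≤ C₀
    have key := tangent_six_reals_sorted (A₀ := B₀) (A₁ := B₁) (B₀ := A₀) (B₁ := A₁) (C₀ := C₀) (C₁ := C₁)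
      hB₀ (by linarith) (by linarith) hB hA hC hB₁ hA₁ hC₁
    have m1 : min B₀ C₀ = B₀ := min_eq_left (by linarith : B₀ ≤ C₀)
    have m2 : min A₀ C₀ = A₀ := min_eq_left (by linarith : A₀ ≤ C₀)
    have m3 : min A₀ B₀ = B₀ := min_eq_right (by linarith : B₀ ≤ A₀)
    have m4 : min A₀ (min B₀ C₀) = B₀ := by rw [m1]; exact min_eq_right (by linarith : B₀ ≤ A₀)
    rw [m4, m1, m2, m3]
    rw [min_comm B₁ A₁] at key
    linarith [key]
  · -- A₀ ≤ B₀ ≤ C₀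
    have key := tangent_six_reals_sorted (A₀ := A₀) (A₁ := A₁) (B₀ := B₀) (B₁ := B₁) (C₀ := C₀) (C₁ := C₁)
      hA₀ (by linarith) (by linarith) hA hB hC hA₁ hB₁ hC₁
    have m1 : min B₀ C₀ = B₀ := min_eq_left (by linarith : B₀ ≤ C₀)
    have m2 : min A₀ C₀ = A₀ := min_eq_left (by linarith : A₀ ≤ C₀)
    have m3 : min A₀ B₀ = A₀ := min_eq_left (by linarith : A₀ ≤ B₀)
    have m4 : min A₀ (min B₀ C₀) = A₀ := by rw [m1]; exact min_eq_left (by linarith : A₀ ≤ B₀)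
    rw [m4, m1, m2, m3]
    linarith [key]
  · -- B₀ ≤ C₀ ≤ A₀
    have key := tangent_six_reals_sorted (A₀ := B₀) (A₁ := B₁) (B₀ := C₀) (B₁ := C₁) (C₀ := A₀) (C₁ := A₁)
      hB₀ (by linarith) (by linarith) hB hC hA hB₁ hC₁ hA₁
    have m1 : min B₀ C₀ = B₀ := min_eq_left (by linarith : B₀ ≤ C₀)
    have m2 : min A₀ C₀ = C₀ := min_eq_right (by linarith : C₀ ≤ A₀)
    have m3 : min A₀ B₀ = B₀ := min_eq_right (by linarith : B₀ ≤ A₀)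
    have m4 : min A₀ (min B₀ C₀) = B₀ := by rw [m1]; exact min_eq_right (by linarith : B₀ ≤ A₀)
    rw [m4, m1, m2, m3]
    rw [min_comm C₁ A₁, min_comm B₁ A₁] at key
    linarith [key]
  · -- C₀ ≤ B₀ ≤ A₀
    have key := tangent_six_reals_sorted (A₀ := C₀) (A₁ := C₁) (B₀ := B₀) (B₁ := B₁) (C₀ := A₀) (C₁ := A₁)
      hC₀ (by linarith) (by linarith) hC hB hA hC₁ hB₁ hA₁
    have m1 : min B₀ C₀ = C₀ := min_eq_right (by linarith : C₀ ≤ B₀)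
    have m2 : min A₀ C₀ = C₀ := min_eq_right (by linarith : C₀ ≤ A₀)
    have m3 : min A₀ B₀ = B₀ := min_eq_right (by linarith : B₀ ≤ A₀)
    have m4 : min A₀ (min B₀ C₀) = C₀ := by rw [m1]; exact min_eq_right (by linarith : C₀ ≤ A₀)
    rw [m4, m1, m2, m3]
    rw [min_comm B₁ A₁, min_comm C₁ A₁, min_comm C₁ B₁] at key
    linarith [key]

end Summit.CriticalPhenomena.PercolationContinuityZ3.Theorems.SahiTangent
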